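/-
Copyright (c) 2026 the pub-hodgecm-mathlib formalisation cell (harness21).  Prover seat hodgecm-mathlib-LH4-p12 (g8), req620 Track A «(D-RAM) FOUR-FRAME» squad
((β₂) road (R-36), β₂-BOARD row (L-Σ): the AXIS COLUMN of the `|α − ρα| = 1` lanes A∕B with NO `hdich` binder — ★ p862391 ∘ ★ (AX-sh) 3∕3), 2026-09-04.
-/
import Summits.HodgeConjecture.HodgeConjecture.Theorems.F0P3cDyRamAxisColumnZeroOfFrame     -- ★ p862391 (this seat): `sum_ite_isOrd_axisCellDiff_eq_zero_of_frame` ∕ `_hyp`, `formCongr_one_antidiagonal_three_eq_endoShape_two`; brings ★ `det_antidiagonal_two`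
import Summits.HodgeConjecture.HodgeConjecture.Theorems.F0P3cDyRamAxisLetterOneClass        -- ★ (LH4-p15 (g0), (AX-sh) 3∕3): `exists_fixed_unit_valueSet_axis_eq_smul_xPlus` (the `hdich` of ★ p862003 on the whole axis column, lanes A∕B)
import HarnessLib

/-!
# Crux `H413`, line LH4 «(D-RAM) FOUR-FRAME» — STAGE-1b, row (2) of `f_{T₊}`, the (β₂) road «PURE-CELL LEDGER» (R-36): β₂-BOARD row (L-Σ)
# «THE AXIS COLUMN OF A TYPE-(2) LITERAL IS ZERO IN THE LANES A∕B — FROM THE LETTERS ALONE» (★ p862391 with its one kept socket `hdich` PAID by ★ (AX-sh) 3∕3)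

Cell `hodgecm-mathlib` (D-0151), FLOOR 0, crux item H413 = `stmt-HodgeConjecture-24833`, route of record `HCCMUnconditional`; squad F0∕P3c∕LH4; lane
`--supports stmt-HodgeConjecture-24833 --as helper` (count-neutral; pays NO tier-0 row).  THEOREMS ONLY (no `def`, no instance, no notation, no `sorry`, default heartbeats);
★-only imports; states NO law; (β₂) and the framed cells letters stay HYPOTHESES.  DATUM-FREE over ★ (C1)'s block-frame binders.

WHY.  ★ p862391 `sum_ite_isOrd_axisCellDiff_eq_zero_of_frame` (WORD #129 (iv)) reduced the axis column `Σ_{j<J+1} [lam ∈ 𝒪_j]·cellDiff(j, 0)` of a literal to ONE named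
per-level hypothesis family `hdich` ((A″)-on-axis, weak shape: self-dual + Γ-fixed + `IsOrd` gifts).  ★ `F0P3cDyRamAxisLetterOneClass.exists_fixed_unit_valueSet_axis_eq_smul_xPlus`
(LH4-p15 (g0), (AX-sh) 3∕3 over ★ p862503 ∕ ★ p862542) proves ★ p862003's `hdich` byte shape at `(ℓ, m_c, a) = (d % 2, mcOfRecord d, 0)` on the WHOLE axis column for the
lanes with `|α − ρα| = 1` (A = Unr-K, B = RamK) from four more frame letters: `2 ≤ d`, `jE` isometric, `Θ lam · lam = 1`, `Θ h = h`.  THIS FILE composes the two (the gifts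
and the guard are dropped by `fun j _ _ g₂ hmem _ _ hsh => …`; `|lam| = 1` is READ from `Θ lam · lam = 1`, `ρ α ≠ α` from `|α − ρα| = 1`):
* `sum_ite_isOrd_axisCellDiff_eq_zero_of_letters` — generic block form `H = ι-shape(H₂, h_W) = formCongr σ P₁ Φ₃` (the ANISO literal at `H₂ := diagonal dg`, `h_W := η`, `γ₂ := γ₁`);
* `sum_ite_isOrd_axisCellDiff_eq_zero_hyp_of_letters` — the HYP literal (`H₂ := Φ₂`, `h_W := 1`, `P₁ := 1`).
So in LH4-p04 (g9)'s lane-B hinge `hbeta2CellsBNear_of_cones` the ‹AXD› binder can be dropped for lanes A∕B: the axis column binds NOTHING beyond the lane letters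
(`hFN` = ★ `forall_fixed_fixed_exists_mul_theta_eq_of_frame` (B) ∕ ★ `forall_fixed_fixed_isNorm_of_typeU` (A); `hs hp` = the «near 1» letters; `h2d` = ★ `two_le_d_of_v_two_lt_one`).
Lane C (RamM, `|α − ρα| < 1`) keeps the ★ p862391 socket until its (AX-sh) twin lands (LH4-p12, memo `AXIS-HDICH-LANEC-SCOPING.v1` 2c5dc5b5: one deeper letter `hp_C`).
HONEST LABEL.  Count-neutral composition; nothing printed is asserted; no census law is stated; (β₂) and the framed cells letters stay HYPOTHESES; `HC_CM` is proved only
modulo the 7 printed citations (2 remaining named inputs: hLiu418 = `stmt-HodgeConjecture-24832`, h413 = `stmt-HodgeConjecture-24833`) until rung 0 closes.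
## References
* [Kottwitz1986BaseChangeUnits] R. E. Kottwitz, *Base change for unit elements of Hecke algebras*, Compositio Math. 60 (1986): §1 pp. 240–241 (signed lattice counts, cell by cell).
* [Rogawski1990] J. D. Rogawski, *Automorphic Representations of Unitary Groups in Three Variables*, Ann. of Math. Stud. 123 (1990): §4.9 Prop. 4.9.1 (b) p. 55 (the labelled census of `f_{T₊}`).
* [Jacobowitz1962] R. Jacobowitz, *Hermitian forms over local fields*, Amer. J. Math. 84 (1962): §4, §7 (unimodular hermitian lines over an order).
* [Serre1979] J.-P. Serre, *Local Fields*, GTM 67 (1979): Ch. III §3 Prop. 7, Ch. V §3 Cor. 3.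
-/

set_option autoImplicit false

noncomputable section

namespace Summit.HodgeConjecture.HodgeConjecture.Cruxes.H413.F0P3cDyRamAxisColumnZeroOfLetters

open scoped Valued WithZero Matrix MatrixGroups Pointwise Classical
open WithZero
open Literature.NumberTheory.Automorphic Literature.NumberTheory.Automorphic.HermitianLattice Literature.NumberTheory.Automorphic.UnitaryLatticeTree
open Literature.NumberTheory.Automorphic.UnitaryThreeFourFrame (IsRamifiedQuadraticDatum)
open Literature.NumberTheory.Rogawski1990
open Summit.HodgeConjecture.HodgeConjecture.Cruxes.H413.F0P3cDyRamFourFramePieces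
open Summit.HodgeConjecture.HodgeConjecture.Cruxes.H413.F0P3cDyRamFourFrameCensusDefs (LatticeInLevel LatticeNearTransvShell)
open Summit.HodgeConjecture.HodgeConjecture.Cruxes.H413.F0P3cDyRamStageOneBDefs (mcOfRecord)
open Summit.HodgeConjecture.HodgeConjecture.Cruxes.H413.F0P3cDyRamToricCensusDefs
open Summit.HodgeConjecture.HodgeConjecture.Cruxes.H413.F0P3cDyRamAxisColumnZeroOfFrame
open Summit.HodgeConjecture.HodgeConjecture.Cruxes.H413.F0P3cDyRamAxisLetterOneClass (exists_fixed_unit_valueSet_axis_eq_smul_xPlus)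

variable {E : Type} {M : Type*} [Field E] [Valued E ℤᵐ⁰] [Field M] [Valued M ℤᵐ⁰] {σ : E →+* E} {ϖ : E} {d t : ℕ} {ρ Θ : M →+* M} {α : M}

/-- **(AX-Σ-letters) «THE AXIS COLUMN OF A TYPE-(2) LITERAL IS ZERO IN THE LANES A∕B, FROM THE LETTERS ALONE».**  ★ p862391 `sum_ite_isOrd_axisCellDiff_eq_zero_of_frame` with
its `hdich` socket PAID by ★ `exists_fixed_unit_valueSet_axis_eq_smul_xPlus` ((AX-sh) 3∕3): frame = ★ (C1)'s block-frame binders (generic block form `ι-shape(H₂, h_W) =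
formCongr σ P₁ Φ₃`, `P₁·ι(γ₂,u)·P₁⁻¹ ∈ U(σ, Φ₃)`, `|u₀₀| = 1`, `|u₀₀ − 1| ≤ |ϖ^{m*}|`, «near 1» letters `hs hp`), the line model with `jE` ISOMETRIC and `|α − ρα| = 1` (lanes
A = Unr-K, B = RamK), `Θ lam · lam = 1`, `Θ h = h`, `2 ≤ d`, and the type-free flip token `hFN`.  THEN `Σ_{j<J+1} [IsOrd (jE ϖ)^j lam]·(#(levelSet(j,0) ∩ q₀₊) − #(levelSet(j,0) ∩ q₀₋′)) = 0`.
[cite: Kottwitz1986BaseChangeUnits, §1 pp. 240–241] [cite: Rogawski1990, §4.9 Prop. 4.9.1 (b) p. 55] [cite: Jacobowitz1962, §4, §7] [cite: Serre1979, Ch. V §3 Cor. 3] -/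
theorem sum_ite_isOrd_axisCellDiff_eq_zero_of_letters [CompleteSpace E] [Finite 𝓀[E]] (hD : IsRamifiedQuadraticDatum σ ϖ d t) (h2d : 2 ≤ d)
    {H₂ : Matrix (Fin 2) (Fin 2) E} (hH₂ : IsUnit H₂.det) {hW : E} (hhW : Valued.v hW = 1) (jE : E →+* M) (hjiso : ∀ a, Valued.v (jE a) = Valued.v a)
    (hρρ : ∀ x, ρ (ρ x) = x) (hvρ : ∀ x, Valued.v (ρ x) = Valued.v x) (hα1 : Valued.v α ≤ 1) (hαρ : Valued.v (α - ρ α) = 1)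
    (hint : ∀ z : M, Valued.v z ≤ 1 → Valued.v ((z - ρ z) / (α - ρ α)) ≤ 1)
    (hΘΘ : ∀ x, Θ (Θ x) = x) (hΘρ : ∀ x, Θ (ρ x) = ρ (Θ x)) (hvΘ : ∀ x, Valued.v (Θ x) = Valued.v x) (hΘj : ∀ x, Θ (jE x) = jE (σ x))
    (hjfix : ∀ z, ρ z = z ↔ ∃ c, jE c = z)
    (φ : (Fin 2 → E) →+ M) (hφs : ∀ (c : E) (x : Fin 2 → E), φ (c • x) = jE c * φ x) (hφi : Function.Injective φ) (hφo : Function.Surjective φ)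
    {γ₂ : GL (Fin 2) E} {lam h : M} (hφγ : ∀ x, φ ((γ₂ : Matrix (Fin 2) (Fin 2) E).mulVec x) = lam * φ x) (hΘlam : Θ lam * lam = 1)
    (hh : h ≠ 0) (hΘh : Θ h = h) (hform : ∀ x y, jE (pairing σ H₂ x y) = h * Θ (φ x) * φ y + ρ (h * Θ (φ x) * φ y))
    (u : GL (Fin 1) E) (hu1 : Valued.v ((u : Matrix (Fin 1) (Fin 1) E) 0 0) = 1) (hum : Valued.v (((u : Matrix (Fin 1) (Fin 1) E) 0 0) - 1) ≤ Valued.v (ϖ ^ mstarOfRecord d))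
    (hFN : ∀ f : M, ρ f = f → Θ f = f → Valued.v f = 1 → ∃ z : M, z * Θ z = f)
    (P₁ : GL (Fin 3) E) (hA : formCongr σ P₁ ((StdForm.antidiagonal 3).over E) = (!![H₂ 0 0, 0, H₂ 0 1; 0, hW, 0; H₂ 1 0, 0, H₂ 1 1] : Matrix (Fin 3) (Fin 3) E))
    (hΓ : P₁ * endoGL (γ₂, u) * P₁⁻¹ ∈ unitaryGroupOfForm σ ((StdForm.antidiagonal 3).over E))
    (hs : Valued.v ((γ₂ : Matrix (Fin 2) (Fin 2) E).trace - 2) * Valued.v (ϖ ^ (d % 2)) ≤ Valued.v (ϖ ^ mcOfRecord d))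
    (hp : Valued.v ((γ₂ : Matrix (Fin 2) (Fin 2) E).det - (γ₂ : Matrix (Fin 2) (Fin 2) E).trace + 1) ≤ Valued.v (ϖ ^ mcOfRecord d))
    (J : ℕ) :
    (∑ j ∈ Finset.range (J + 1), (if IsOrd ρ α (jE ϖ ^ j) lam then
      ((levelSet ρ Θ α (jE ϖ) h j 0 ∩ {Λ | ∃ g₂ : GL (Fin 2) E, (latt (g₂ : Matrix (Fin 2) (Fin 2) E)).toAddSubgroup.map φ = Λ ∧
          (LatticeNearTransvShell ϖ (d % 2) (mstarOfRecord d) ((((endoGL (γ₂, u) : GL (Fin 3) E) : Matrix (Fin 3) (Fin 3) E) - 1)) (latt ((endoGL (g₂, (1 : GL (Fin 1) E)) : GL (Fin 3) E) : Matrix (Fin 3) (Fin 3) E)) ∧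
            {z : E | ∃ y ∈ latt ((endoGL (g₂, (1 : GL (Fin 1) E)) : GL (Fin 3) E) : Matrix (Fin 3) (Fin 3) E), Valued.v ((ϖ ^ (mstarOfRecord d))⁻¹ * (z - pairing σ (!![H₂ 0 0, 0, H₂ 0 1; 0, hW, 0; H₂ 1 0, 0, H₂ 1 1] : Matrix (Fin 3) (Fin 3) E) y (((((endoGL (γ₂, u) : GL (Fin 3) E) : Matrix (Fin 3) (Fin 3) E) - 1)) *ᵥ y))) ≤ 1} = valueSetMod σ ϖ (mstarOfRecord d) (xPlus σ ϖ d))}).ncard : ℤ) -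
        ((levelSet ρ Θ α (jE ϖ) h j 0 ∩ {Λ | ∃ g₂ : GL (Fin 2) E, (latt (g₂ : Matrix (Fin 2) (Fin 2) E)).toAddSubgroup.map φ = Λ ∧
          (LatticeNearTransvShell ϖ (d % 2) (mcOfRecord d) ((((endoGL (γ₂, u) : GL (Fin 3) E) : Matrix (Fin 3) (Fin 3) E) - 1)) (latt ((endoGL (g₂, (1 : GL (Fin 1) E)) : GL (Fin 3) E) : Matrix (Fin 3) (Fin 3) E)) ∧
            ¬ {z : E | ∃ y ∈ latt ((endoGL (g₂, (1 : GL (Fin 1) E)) : GL (Fin 3) E) : Matrix (Fin 3) (Fin 3) E), Valued.v ((ϖ ^ (mstarOfRecord d))⁻¹ * (z - pairing σ (!![H₂ 0 0, 0, H₂ 0 1; 0, hW, 0; H₂ 1 0, 0, H₂ 1 1] : Matrix (Fin 3) (Fin 3) E) y (((((endoGL (γ₂, u) : GL (Fin 3) E) : Matrix (Fin 3) (Fin 3) E) - 1)) *ᵥ y))) ≤ 1} = valueSetMod σ ϖ (mstarOfRecord d) (xPlus σ ϖ d))}).ncard : ℤ)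
      else 0)) = 0 := by
  have hα : ρ α ≠ α := fun h0 => by rw [h0, sub_self, map_zero] at hαρ; exact zero_ne_one hαρ
  have hjv : ∀ c, Valued.v (jE c) ≤ 1 ↔ Valued.v c ≤ 1 := fun c => by rw [hjiso]
  have hjpow : ∀ (t : E) (n : ℤ), Valued.v (jE t) = Valued.v (jE ϖ) ^ n ↔ Valued.v t = Valued.v ϖ ^ n := fun t n => by rw [hjiso, hjiso]
  have hlam : Valued.v lam = 1 := by
    have h1 := congrArg Valued.v hΘlam
    rw [map_mul, hvΘ, map_one] at h1
    exact eq_one_of_mul_self_eq_one h1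
  exact sum_ite_isOrd_axisCellDiff_eq_zero_of_frame hD hH₂ hhW jE hρρ hvρ hα hα1 hint hΘΘ hΘρ hvΘ hΘj hjv hjfix hjpow φ hφs hφi hφo hφγ hlam hh hform u hu1 hum
    hFN P₁ hA hΓ hs hp J
    (fun j _ _ g₂ hmem _ _ hsh => exists_fixed_unit_valueSet_axis_eq_smul_xPlus hD h2d H₂ hhW.le jE hjiso hρρ hvρ hα1 hαρ hint hΘΘ hΘρ hvΘ hjfix hΘj φ hφs hφi
      hφγ hΘlam hh hΘh hform u hum j hmem hsh)

/-- **(AX-Σ-letters) AT THE HYPERBOLIC LITERAL** (`H₂ := Φ₂`, `h_W := 1`, `P₁ := 1`; `Γ = ι(γ₂, u) ∈ U(σ, Φ₃)` as is): the axis column of the HYP literal of ★ `beta2Cells{A,B}Frame`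
is `0`, no `hdich` binder. [cite: Kottwitz1986BaseChangeUnits, §1 pp. 240–241] [cite: Rogawski1990, §4.9 Prop. 4.9.1 (b) p. 55] [cite: Jacobowitz1962, §4, §7] [cite: Serre1979, Ch. V §3 Cor. 3] -/
theorem sum_ite_isOrd_axisCellDiff_eq_zero_hyp_of_letters [CompleteSpace E] [Finite 𝓀[E]] (hD : IsRamifiedQuadraticDatum σ ϖ d t) (h2d : 2 ≤ d)
    (jE : E →+* M) (hjiso : ∀ a, Valued.v (jE a) = Valued.v a)
    (hρρ : ∀ x, ρ (ρ x) = x) (hvρ : ∀ x, Valued.v (ρ x) = Valued.v x) (hα1 : Valued.v α ≤ 1) (hαρ : Valued.v (α - ρ α) = 1)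
    (hint : ∀ z : M, Valued.v z ≤ 1 → Valued.v ((z - ρ z) / (α - ρ α)) ≤ 1)
    (hΘΘ : ∀ x, Θ (Θ x) = x) (hΘρ : ∀ x, Θ (ρ x) = ρ (Θ x)) (hvΘ : ∀ x, Valued.v (Θ x) = Valued.v x) (hΘj : ∀ x, Θ (jE x) = jE (σ x))
    (hjfix : ∀ z, ρ z = z ↔ ∃ c, jE c = z)
    (φ : (Fin 2 → E) →+ M) (hφs : ∀ (c : E) (x : Fin 2 → E), φ (c • x) = jE c * φ x) (hφi : Function.Injective φ) (hφo : Function.Surjective φ)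
    {γ₂ : GL (Fin 2) E} {lam h : M} (hφγ : ∀ x, φ ((γ₂ : Matrix (Fin 2) (Fin 2) E).mulVec x) = lam * φ x) (hΘlam : Θ lam * lam = 1)
    (hh : h ≠ 0) (hΘh : Θ h = h) (hform : ∀ x y, jE (pairing σ ((StdForm.antidiagonal 2).over E) x y) = h * Θ (φ x) * φ y + ρ (h * Θ (φ x) * φ y))
    (u : GL (Fin 1) E) (hu1 : Valued.v ((u : Matrix (Fin 1) (Fin 1) E) 0 0) = 1) (hum : Valued.v (((u : Matrix (Fin 1) (Fin 1) E) 0 0) - 1) ≤ Valued.v (ϖ ^ mstarOfRecord d))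
    (hFN : ∀ f : M, ρ f = f → Θ f = f → Valued.v f = 1 → ∃ z : M, z * Θ z = f)
    (hΓ : endoGL (γ₂, u) ∈ unitaryGroupOfForm σ ((StdForm.antidiagonal 3).over E))
    (hs : Valued.v ((γ₂ : Matrix (Fin 2) (Fin 2) E).trace - 2) * Valued.v (ϖ ^ (d % 2)) ≤ Valued.v (ϖ ^ mcOfRecord d))
    (hp : Valued.v ((γ₂ : Matrix (Fin 2) (Fin 2) E).det - (γ₂ : Matrix (Fin 2) (Fin 2) E).trace + 1) ≤ Valued.v (ϖ ^ mcOfRecord d))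
    (J : ℕ) :
    (∑ j ∈ Finset.range (J + 1), (if IsOrd ρ α (jE ϖ ^ j) lam then
      ((levelSet ρ Θ α (jE ϖ) h j 0 ∩ {Λ | ∃ g₂ : GL (Fin 2) E, (latt (g₂ : Matrix (Fin 2) (Fin 2) E)).toAddSubgroup.map φ = Λ ∧
          (LatticeNearTransvShell ϖ (d % 2) (mstarOfRecord d) ((((endoGL (γ₂, u) : GL (Fin 3) E) : Matrix (Fin 3) (Fin 3) E) - 1)) (latt ((endoGL (g₂, (1 : GL (Fin 1) E)) : GL (Fin 3) E) : Matrix (Fin 3) (Fin 3) E)) ∧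
            {z : E | ∃ y ∈ latt ((endoGL (g₂, (1 : GL (Fin 1) E)) : GL (Fin 3) E) : Matrix (Fin 3) (Fin 3) E), Valued.v ((ϖ ^ (mstarOfRecord d))⁻¹ * (z - pairing σ (!![((StdForm.antidiagonal 2).over E) 0 0, 0, ((StdForm.antidiagonal 2).over E) 0 1; 0, (1 : E), 0; ((StdForm.antidiagonal 2).over E) 1 0, 0, ((StdForm.antidiagonal 2).over E) 1 1] : Matrix (Fin 3) (Fin 3) E) y (((((endoGL (γ₂, u) : GL (Fin 3) E) : Matrix (Fin 3) (Fin 3) E) - 1)) *ᵥ y))) ≤ 1} = valueSetMod σ ϖ (mstarOfRecord d) (xPlus σ ϖ d))}).ncard : ℤ) -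
        ((levelSet ρ Θ α (jE ϖ) h j 0 ∩ {Λ | ∃ g₂ : GL (Fin 2) E, (latt (g₂ : Matrix (Fin 2) (Fin 2) E)).toAddSubgroup.map φ = Λ ∧
          (LatticeNearTransvShell ϖ (d % 2) (mcOfRecord d) ((((endoGL (γ₂, u) : GL (Fin 3) E) : Matrix (Fin 3) (Fin 3) E) - 1)) (latt ((endoGL (g₂, (1 : GL (Fin 1) E)) : GL (Fin 3) E) : Matrix (Fin 3) (Fin 3) E)) ∧
            ¬ {z : E | ∃ y ∈ latt ((endoGL (g₂, (1 : GL (Fin 1) E)) : GL (Fin 3) E) : Matrix (Fin 3) (Fin 3) E), Valued.v ((ϖ ^ (mstarOfRecord d))⁻¹ * (z - pairing σ (!![((StdForm.antidiagonal 2).over E) 0 0, 0, ((StdForm.antidiagonal 2).over E) 0 1; 0, (1 : E), 0; ((StdForm.antidiagonal 2).over E) 1 0, 0, ((StdForm.antidiagonal 2).over E) 1 1] : Matrix (Fin 3) (Fin 3) E) y (((((endoGL (γ₂, u) : GL (Fin 3) E) : Matrix (Fin 3) (Fin 3) E) - 1)) *ᵥ y))) ≤ 1} = valueSetMod σ ϖ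 (mstarOfRecord d) (xPlus σ ϖ d))}).ncard : ℤ)
      else 0)) = 0 :=
  sum_ite_isOrd_axisCellDiff_eq_zero_of_letters hD h2d (by rw [det_antidiagonal_two]; exact isUnit_one.neg) (map_one _) jE hjiso hρρ hvρ hα1 hαρ hint hΘΘ hΘρ hvΘ hΘj
    hjfix φ hφs hφi hφo hφγ hΘlam hh hΘh hform u hu1 hum hFN 1 (formCongr_one_antidiagonal_three_eq_endoShape_two σ) (by rwa [one_mul, inv_one, mul_one]) hs hp J

end Summit.HodgeConjecture.HodgeConjecture.Cruxes.H413.F0P3cDyRamAxisColumnZeroOfLetters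

end
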